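import Literature.MathematicalPhysics.QuantumFieldTheory.BalabanImbrieJaffe1984to88.BIJ88Close231RegularTorusCwt

/-!
# `BalabanImbrieJaffe1984to88.BIJ88Decay241RegularTorusCwt` — T. Bałaban, J. Imbrie, A. Jaffe, *Effective action and cluster properties of
the abelian Higgs model*, Commun. Math. Phys. **114** (1988) 257–315 [BalabanImbrieJaffe1988], §2 (2.38)–(2.41) p. 264 [PDF 8] and (4.9)
p. 275 [PDF 19]: **(2.38), (2.40)/(4.9)_{j≥1} AND (2.41) FOR `Δ_{k,loc}(u)` WITH `Ω = T_η` AT A (2.23)-REGULAR NON-FLAT BACKGROUND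
`u = e^{ieεA}`, FOR THE PRINTED LOCALIZATION DATA OF RECORD WITH BIG-BLOCK CUBES** — the three members of p31 gen 20's row-restricted chain
(`BIJ88DeltaLocClose235General` §10: `ineq238_gen`, `Z49_gen`, `decay241_gen`) that r18 gen 24's `BIJ88Close231RegularTorusCwt` ((2.30), (2.31),
(2.35), (2.36)) does not take, instantiated on the SAME data (p29's torus weights `λ_α` (2.27) and p13's cut-off `ζ″` (2.29), the cubes replaced
by their big-block hulls `cubeFamB`) and the SAME inputs (r18's `inputs_regular` = r01 gen 26's (2.23)-regular providers of [7] (1.10)/(1.12) at one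
set of constants), with the plaquette size of `u = e^{ieεA}` DERIVED from the (2.23)-regularity of `A` (§1) and the [I] (4.5.4)-type smallness of
the averaged field `u_k` displayed (and, in §7, derived from a sup bound on `A`).

statement-level skeleton of published theorems with citation tags; proofs where landed; nothing here is a claim about the Yang–Mills mass gap

PDF held: `paper:balaban1988-cmp114-bij-abelian-higgs-effective-action` (journal page = PDF page + 256; p. 264 = PDF 8, p. 275 = PDF 19);
`paper:balaban1985-cmp97-bij-higgs-minimizers` (journal page = PDF page + 298; p. 326 = PDF 28, re-read this session: *«by change of gauge u_k
can be transformed in a local region Λ into a configuration of the form exp[ie_kηA], where A is smooth and small»*).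

CITATION HEADER (lean-in-tree rule).  lit-balaban cell (HOME `run/shared/lean/pub/lit-balaban/`), Phase 2, proof seat **p31 gen 21** (unit
`lit-balaban-p31`, literature-prover-lit-balaban-p31-g21-0), free-target protocol G.5-34(d), TAKING line HOME/STATUS.md 2026-08-23T02:13:35Z
(successor item of this seat's gen 20 HANDOFF: *"the INSTANTIATION file (non-flat (2.38)/(2.40)/(2.41)/(4.9) as hypothesis-free theorems at
(2.23)-regular u)"*; stem check `…241Regular…` = ∅; notices to r18 / r01 / p29).  Rows of `HOME/lit-balaban-r18/ROWS-C2.md` served (LOCATED MEMBERS,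
cells only; heads unchanged; owner r18): **C2.Eq2.38** (head p02's `BIJ88Ineq238Proof`), **C2.Eq2.40**, **C2.Eq2.41** (+ the (4.9)_{j≥1} token of
C3).  Files USED BY NAME, nothing restated: p31 g20 `BIJ88DeltaLocClose235General` v1.1 (`ineq238_gen`, `Z49_gen`, `decay241_gen`; p346675),
r18 g24 `BIJ88Close231RegularTorusCwt` (`inputs_regular`, `rowHyp_ii_hull`, `cubeFamB`, `deepRows`, `rowMargin`, `bbHull_bigBlock`; p347978),
r01 g25/g26 `BIJ85NeumannPropagatorRegularDecay.isBlockUnion_of_bigBlocks` / `BIJ85CovariantHiggsDictionary` (`expGauge`, `toC_expGauge`,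
`toC_lineIter`), p29 gen 26/27 `BIJ88LocWeights227Torus` (`lamFam`, `labels`, `lamT_comm`, `rowHyp_i`, `rowHyp_iii`, `cutoff_eq_zero_of_le`,
`cutoff_mem_unitInterval`, `sum_abs_lamT_le_one`, `mem_and_depth_of_mem_blockK`, `activeLabels`, `card_activeLabels_le`,
`mem_activeLabels_of_ne_zero_of_deep`), p13 `BIJ88Cutoffs21` (`cutoff`, `cutoff_congr_dist`), r15/p11 `BIJ85AbelianStokes.plaqC`,
`BIJ85Ineq732FlatRegion.starB_innerK_univ`, gen 15 `BIJ88DeltaLoc234Torus.deltaLocT`, gen 18 `BIJ88Eq240FlatTorus` (`realify`, `compress`,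
`op240`, `c240`), p03 `BIJ88Normalization46.Z49`, pv07 `B4Sect5Proof.latticeConst`, p38 `B5Ineq137Torus.T`.

## The print (verbatim, p. 264 [PDF 8]; p. 275 [PDF 19])

*"Finally, in view of (2.35), the lower bound (I.7.3.2) applies to Δ_{k,loc}(u) as well. Let φ be supported in a region having an r(e_k)
neighborhood where u is smooth. Then ⟨φ, Δ_{k,loc}(u)φ⟩ ≧ c₁ Σ_b |u(b)φ(b₊) − φ(b₋)|² − c e_k² p(e_k)² Σ_x |φ(x)|². (2.38) Finally, we need to construct
a localized version of C^{(k)}_Λ(Ω, u) = [(Δ_k(Ω, u) + aL^{−2} Q(u_k)^* Q(u_k))|_Λ]^{−1}, (2.39) the single-scale propagator for the scalar field in the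
k-th step. We have already replaced Δ_k(Ω, u) with Δ_{k,loc}(u). Let us assume u is smooth in a neighborhood of Λ̄, the region for the Dirichlet
boundary conditions in (2.39). We define C^{(k)}_Λ(u) = [(Δ_{k,loc}(u) + aL^{−2} Q(u_k)^* Q(u_k))|_Λ]^{−1}. (2.40) This is of course a nonlocal operator,
but by (2.38), C^{(k)}_Λ(u)^{−1} is bounded below and a random walk expansion as in [6] can be used to prove that |C^{(k)}_Λ(u; x₁, x₂)| ≦ c e^{−c|x₁−x₂|}.
(2.41)"*
(v1.1 DOC-ONLY, gen 22: this block is now the verbatim print — PDF p0008 L2–15, referee asks ref-1 g78/g79 and ref-5 D-g65-3: the printed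
(2.38) carries the support condition on φ; (2.39) is the region propagator C^{(k)}_Λ(Ω,u), (2.40) the localized C^{(k)}_Λ(u); the earlier text
«An important consequence of (2.35) …» / «… bounded below (2.40)» was a paraphrase with the labels (2.39)/(2.40) swapped. No declaration changed.);
p. 275: *"Z^{(j)}_Λ = ∫ dφ_Λ exp[−½⟨φ, (Δ + κP(u))|_Λ φ⟩ − E|Λ|] (4.9)"* (the Gaussian normalization, `j ≥ 1`).  Here `Ω = T_η` and `u = e^{ieεA}`
with `A` (2.23)-regular on the whole torus ([BalabanImbrieJaffe1985] p. 326 / [Balaban1982Higgs1] Prop. 2.1 (2.23): `L^kε|e|/e_k·|∂A| ≦ c·e_k^{β−1}/L^k`,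
`0 < e_k ≦ e₁`), the hypothesis under which r01's providers deliver [7]'s (1.10)/(1.12).

## What is proved (0 `sorry`; theorems only — no definition, no `Prop`-valued fact)

* §1 **the plaquette variables of `u = e^{ieεA}`**: `plaqC_expGauge` (`u(∂p) = exp(ieε·(curl A)(p))`), `norm_plaqC_expGauge_sub_one_le`
  (`‖u(∂p) − 1‖ ≤ ε|e|·|(curl A)(p)|`), **`norm_plaqC_expGauge_sub_one_le_of_regular`** (at a (2.23)-regular `A`: `‖u(∂p) − 1‖ ≤ 2c·e_k^β/L^{2k}`
  — so the [I] (7.3.2) field-strength term `(4/3)d⁴(L^{2k}θ)²` of p11/p31's (2.38) reads `(4/3)d⁴(2c·e_k^β)²`, print's `c e_k²p(e_k)²` shape).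
* §2 data glue: `lamFam_symm`, `cutoff_T_symm` (the Hermitian symmetry of `Δ_{k,loc}`), **`isBlockUnion_bbHull`** / `isBlockUnion_cubeFamB` (the
  big-block hulls are `k`-block unions — r01's `isBlockUnion_of_bigBlocks` with r18's `bbHull_bigBlock`).
* §3 **`rows_of_deep`**: the five row hypotheses (i), (ii″), (iii), `X₀ = T^{(0)}` and the multiplicity `#S ≤ m = (⌊(L^k − 1 + R₀)/s_g⌋ + 3)^{d+1}` of
  p31's `_gen` members for the block of a `k`-site `y₁` lying in the reference box `Ω₀` at chart depth `≥ R₀ + R` (p29 §3–§4 + r18's `rowHyp_ii_hull`).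
* §4 **`ineq238_regular_torus_cwt`** — (2.38) for `Δ_{k,loc}(e^{ieεA})`: `∃ s₀ ∀ s ≥ s₀ ∃ c₀ e₁ > 0` (from `(d, L, a, e, c, β, s)` only) such that on
  every torus of the series, every level `1 ≤ k ≤ K` with `k + s ≤ m + K`, `3L^kL^s ≤ |T^{(0)}|`, every `A` regular on `T^{(0)}` (`0 < e_k ≤ e₁`),
  every reference no-wrap box `Ω₀` with torus gap `≥ R`, spacing `s_g ≥ 1`, half-width `W ≥ 2s_g/3 + R₀/2 + R`, radii `R > rowMargin`, `0 ≤ R₁ < R₀`,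
  and every `φ` supported on `k`-sites whose blocks lie in `Ω₀` at chart depth `≥ R₀ + R`:
  `(A/a_k)·[γ₀ Σ_b ‖u_k(b)φ(b₊) − φ(b₋)‖² − (4/3·d′⁴(2c e_k^β)² + a_k²c₀e^{δ₀/2}K_{d′}(δ₀/2)(m e^{−2δ₀R/L^k} + e^{−(δ₀/2)R₁/L^k}))·‖φ‖²] ≤ Re⟨φ, Δ_{k,loc}(u)φ⟩`,
  `γ₀ = min(a/(9d′), 1/12)`, `δ₀ = 1/(8L^s)`, `d′ = d + 1 = P.d`, `A = α_kL^{kd′}` (gen 15's counting normalization), `u_k = lineIter u k`.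
* §5 **`Z49_regular_torus_cwt`** — (2.40) and (4.9)_{j≥1}: under the same data, for every `Λ` of such `k`-sites, every averaged-field smallness
  `(T₁, δ′, σ)` of `u_k` inside the `L`-blocks of `T^{(k)}` ([I] (4.5.4) shape, as in gen 19's `decay241_deltaRegion_smallField`), `κ′ ≥ 0` and the
  printed largeness condition `E < c240(γ₀, κ′)(1 − σ)` (radii `≫ L^k`, `e_k` small): `realify((Δ_{k,loc}(u) + (A/a_k)κ′P(u_k))|_Λ)` is positive
  definite, `Z^{(k)}_Λ = e^{−E|Λ|}(2π)^{#Λ}/√det`, `Z^{(k)}_Λ > 0` — p31's `Z49_gen` BY NAME.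
* §6 **`decay241_regular_torus_cwt`** — (2.41): under the same data and the smallness `ϑ ≤ δ₀/4`, `ϑ·W(…) ≤ (c240(1−σ) − E)/2`:
  `‖C^{(k)}_Λ(u; x₁, x₂)‖ ≤ (a_k/A)·(4/(c240(1−σ) − E))·e^{−ϑ|x₁−x₂|_{T^{(k)}}}` for all `x₁, x₂ ∈ Λ` — p31's `decay241_gen` BY NAME.
* §7 **the averaged-field smallness from a sup bound on `A`** (*«A is smooth and small»*): `norm_toC_lineIter_expGauge_sub_one_le`
  (`‖u_k(b) − 1‖ ≤ L^kε|e|·‖A‖_∞`, r01's `toC_lineIter`), `norm_holCK_one_sub_one_le` (`‖u_k(Γ_{yx}) − 1‖ ≤ d′(L−1)T₁`), and the corollaries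
  **`Z49_regular_torus_cwt_of_sup`**, **`decay241_regular_torus_cwt_of_sup`** with `T₁ = L^kε|e|‖A‖_∞`, `δ′ = d′(L−1)T₁`.

HONEST SCOPE / DIVERGENCE.  (i) `Ω = T_η` only and `u` EXACTLY `e^{ieεA}` with `A` (2.23)-regular on the whole torus (r18's HONEST (ii)/(iii)
verbatim; no change of gauge — the conclusions of §5/§6 are gauge invariant in the sense of gen 19's §5, not restated).  (ii) The cubes are the
big-block hulls `cubeFamB` of p29's cubes (r18's HONEST (iv)).  (iii) Constants: `s₀`, `c₀`, `e₁` existential (r01's thresholds), `δ₀ = 1/(8L^s)`,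
`γ₀`, the (7.3.2) term and the brackets explicit; the largeness/smallness CONDITIONS of (2.40)/(2.41) (`hE`, `hσ`, `hsmall`) are displayed numeric
hypotheses exactly as in the `_gen` members — print's *"by (2.38), C^{(k)}_Λ(u)^{−1} is bounded below"* located (they hold at the printed radii
`R, R₁ ~ r(e_k)L^k` for `e_k` small, which is not asserted here as a theorem since `c₀` is existential).  (iv) (2.38) is p02's two-constant
reading with the (2.35) error explicit (HOME/GAPS.md G-C2-06), for `φ` supported on deep `k`-sites (print: all `φ`; the localization error is
only controlled away from `∂Ω₀` — the `_gen` row restriction).  (v) Value members; `1 ≤ k`, fine level `0`; `k + 1 ≤ m + K` in §5–§7 (the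
`L`-blocks of `P(u_k)`).  Imports: r18 `BIJ88Close231RegularTorusCwt` only (→ p31 `BIJ88DeltaLocClose235General`, r01, p29).  Literature +
Mathlib only.  Unit `lit-balaban-p31` (literature-prover-lit-balaban-p31-g21-0), 2026-08-23.  NOT summit progress.
-/

open scoped BigOperators Matrix ComplexConjugate
open Finset Matrix

namespace Literature.MathematicalPhysics.QuantumFieldTheory.BalabanImbrieJaffe1984to88.BIJ88Decay241RegularTorusCwt

open Literature.MathematicalPhysics.QuantumFieldTheory.Balaban1983to89
open BIJ88Sect3Statements (U1 toC starB norm_toC)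
open BIJ85BlockAveragesTorus BIJ85BlockAveragesTorusK
open BIJ88NeumannPropagator227Torus (gBox)
open BIJ88DeltaLoc234Torus (gLocT deltaLocT deltaRegion)
open BIJ88NeumannPropagatorFlatDecayCube (cubeT boxCoord)
open BIJ88Cutoffs21 (cutoff cutoff_congr_dist)
open BIJ88LocWeights227Torus
open BIJ85CovariantHiggsDictionary (expGauge toC_expGauge toC_lineIter)
open BIJ88DeltaLocClose235General (ineq238_gen Z49_gen decay241_gen)
open BIJ88Close231RegularTorusCwt (bbHull bbHull_bigBlock cubeFamB deepRows mem_deepRows rowMargin inputs_regular rowHyp_ii_hull)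
open BIJ85AbelianStokes (plaqC)
open BIJ88NeumannNoZeroModesTorus (IsBlockUnion innerK isBlockUnion_univ)
open BIJ85Ineq732FlatRegion (starB_innerK_univ)
open BIJ88Eq240FlatTorus (realify compress op240 c240)
open BIJ88Normalization46 (Z49)
open B4Sect5Proof (latticeConst)
open BIJ85NeumannPropagatorRegularDecay (isBlockUnion_of_bigBlocks)
open BIJ88RenormTransf311 (inBlock)

noncomputable section

variable {P : Params}

/-! ## §1 The plaquette variables of `u = e^{ieεA}` and their size at a (2.23)-regular `A` -/

section Plaquette

/-- **`u(∂p) = exp(ieε·(curl A)(p))`** for `u = e^{ieεA}` (abelian: the oriented plaquette variable (2.5) of [I] is the exponential of the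
lattice curl `A(x,x+e_μ) + A(x+e_μ,·+e_ν) − A(x+e_ν,·+e_μ) − A(x,x+e_ν)`). [cite: BalabanImbrieJaffe1985, (2.5) p.302] -/
theorem plaqC_expGauge (e : ℝ) (A : PBond P 0 → ℝ) (x : Balaban1983to89.Site P 0) (μ ν : Fin P.d) :
    plaqC (expGauge P e A) x μ ν =
      Complex.exp ((P.eps * e * (A ⟨x, μ⟩ + A ⟨x.shift μ, ν⟩ - A ⟨x.shift ν, μ⟩ - A ⟨x, ν⟩) : ℝ) * Complex.I) := by
  simp only [plaqC, toC_expGauge, ← Complex.exp_neg, ← Complex.exp_add]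
  congr 1
  push_cast
  ring

/-- **`‖u(∂p) − 1‖ ≤ ε|e|·|(curl A)(p)|`** for `u = e^{ieεA}` (`|e^{it} − 1| ≤ |t|`). [cite: BalabanImbrieJaffe1985, (7.3.1) p.326] -/
theorem norm_plaqC_expGauge_sub_one_le (e : ℝ) (A : PBond P 0 → ℝ) (x : Balaban1983to89.Site P 0) (μ ν : Fin P.d) :
    ‖plaqC (expGauge P e A) x μ ν - 1‖ ≤ P.eps * |e| * |A ⟨x, μ⟩ + A ⟨x.shift μ, ν⟩ - A ⟨x.shift ν, μ⟩ - A ⟨x, ν⟩| := by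
  rw [plaqC_expGauge, mul_comm _ Complex.I]
  refine Real.norm_exp_I_mul_ofReal_sub_one_le.trans (le_of_eq ?_)
  rw [Real.norm_eq_abs, abs_mul, abs_mul, abs_of_pos P.eps_pos]

/-- **THE PLAQUETTE SIZE AT A (2.23)-REGULAR `A`**: if `L^kε|e|/e_k·|A(⟨z+e_μ,ν⟩) − A(⟨z,ν⟩)| ≦ c·e_k^{β−1}/L^k` for all `z, μ, ν` ([B1] (2.23) in
r01's form, `0 < e_k`), then `‖u(∂p) − 1‖ ≤ 2c·e_k^β/(L^k)²` for `u = e^{ieεA}` and every plaquette — the (7.3.1)-type field-strength bound of [I]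
p. 326 for the configuration *«exp[ie_kηA], where A is smooth and small»*. [cite: BalabanImbrieJaffe1985, (7.3.1) p.326] -/
theorem norm_plaqC_expGauge_sub_one_le_of_regular {k : ℕ} {e creg β ec : ℝ} (hec : 0 < ec) {A : PBond P 0 → ℝ}
    (hreg : ∀ (z : Balaban1983to89.Site P 0) (μ ν : Fin P.d),
      P.spacing k * |e| / ec * |A ⟨z.shift μ, ν⟩ - A ⟨z, ν⟩| ≤ creg * ec ^ (β - 1) / (P.L : ℝ) ^ k)
    (x : Balaban1983to89.Site P 0) (μ ν : Fin P.d) :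
    ‖plaqC (expGauge P e A) x μ ν - 1‖ ≤ 2 * creg * ec ^ β / ((P.L : ℝ) ^ k) ^ 2 := by
  have hLk : (0 : ℝ) < (P.L : ℝ) ^ k := pow_pos P.cast_L_pos k
  have hε := P.eps_pos
  have key : ∀ (z : Balaban1983to89.Site P 0) (μ ν : Fin P.d),
      P.eps * |e| * |A ⟨z.shift μ, ν⟩ - A ⟨z, ν⟩| ≤ creg * ec ^ β / ((P.L : ℝ) ^ k) ^ 2 := by
    intro z μ ν
    have h := mul_le_mul_of_nonneg_right (hreg z μ ν) (div_pos hec hLk).le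
    have e1 : P.spacing k * |e| / ec * |A ⟨z.shift μ, ν⟩ - A ⟨z, ν⟩| * (ec / (P.L : ℝ) ^ k) =
        P.eps * |e| * |A ⟨z.shift μ, ν⟩ - A ⟨z, ν⟩| := by
      unfold Params.spacing
      field_simp
    have e2 : creg * ec ^ (β - 1) / (P.L : ℝ) ^ k * (ec / (P.L : ℝ) ^ k) = creg * ec ^ β / ((P.L : ℝ) ^ k) ^ 2 := by
      rw [Real.rpow_sub_one hec.ne']
      field_simp
    rwa [e1, e2] at h
  refine (norm_plaqC_expGauge_sub_one_le e A x μ ν).trans ?_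
  have htri : |A ⟨x, μ⟩ + A ⟨x.shift μ, ν⟩ - A ⟨x.shift ν, μ⟩ - A ⟨x, ν⟩| ≤
      |A ⟨x.shift μ, ν⟩ - A ⟨x, ν⟩| + |A ⟨x.shift ν, μ⟩ - A ⟨x, μ⟩| := by
    rw [show A ⟨x, μ⟩ + A ⟨x.shift μ, ν⟩ - A ⟨x.shift ν, μ⟩ - A ⟨x, ν⟩ =
      (A ⟨x.shift μ, ν⟩ - A ⟨x, ν⟩) - (A ⟨x.shift ν, μ⟩ - A ⟨x, μ⟩) by ring]
    exact abs_sub _ _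
  calc P.eps * |e| * |A ⟨x, μ⟩ + A ⟨x.shift μ, ν⟩ - A ⟨x.shift ν, μ⟩ - A ⟨x, ν⟩|
      ≤ P.eps * |e| * (|A ⟨x.shift μ, ν⟩ - A ⟨x, ν⟩| + |A ⟨x.shift ν, μ⟩ - A ⟨x, μ⟩|) :=
        mul_le_mul_of_nonneg_left htri (by positivity)
    _ = P.eps * |e| * |A ⟨x.shift μ, ν⟩ - A ⟨x, ν⟩| + P.eps * |e| * |A ⟨x.shift ν, μ⟩ - A ⟨x, μ⟩| := by ring
    _ ≤ creg * ec ^ β / ((P.L : ℝ) ^ k) ^ 2 + creg * ec ^ β / ((P.L : ℝ) ^ k) ^ 2 := add_le_add (key x μ ν) (key x ν μ)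
    _ = 2 * creg * ec ^ β / ((P.L : ℝ) ^ k) ^ 2 := by ring

/-- kernel: `(L^{2k}·θ)² = (2c·e_k^β)²` for the regular plaquette size `θ = 2c·e_k^β/L^{2k}` (the (7.3.2) field-strength term of (2.38)). [folklore] -/
private theorem fieldStrength_sq_regular (k : ℕ) (creg β ec : ℝ) :
    (((P.L : ℝ) ^ k) ^ 2 * (2 * creg * ec ^ β / ((P.L : ℝ) ^ k) ^ 2)) ^ 2 = (2 * creg * ec ^ β) ^ 2 := by
  have hLk : (0 : ℝ) < (P.L : ℝ) ^ k := pow_pos P.cast_L_pos k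
  rw [mul_div_cancel₀ _ (pow_pos hLk 2).ne']

end Plaquette

/-! ## §2 Data glue: symmetry of the weights and of the cut-off; the big-block hulls are `k`-block unions -/

section Glue

variable {d : ℕ}

/-- the (2.27) torus weights are symmetric, `λ_α(x₂, x₁) = λ_α(x₁, x₂)` (p29's `lamT_comm`, family form). [cite: BalabanImbrieJaffe1988, (2.27) p.263] -/
theorem lamFam_symm (hPd : P.d = d + 1) (n : ℕ) (c M0 : Fin (d + 1) → ℕ) (s : ℕ) (α : ↥(labels n M0 s))
    (x₁ x₂ : Balaban1983to89.Site P 0) : lamFam hPd n c M0 s α x₂ x₁ = lamFam hPd n c M0 s α x₁ x₂ :=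
  lamT_comm α.1 x₂ x₁

/-- the (2.29) cut-off in the sup-torus distance is symmetric, `ζ″(x₂, x₁) = ζ″(x₁, x₂)`. [cite: BalabanImbrieJaffe1988, (2.29) p.263] -/
theorem cutoff_T_symm (R₁ R₀ : ℝ) (x₁ x₂ : Balaban1983to89.Site P 0) :
    cutoff R₁ R₀ (B5Ineq137Torus.T P 0) x₂ x₁ = cutoff R₁ R₀ (B5Ineq137Torus.T P 0) x₁ x₂ :=
  cutoff_congr_dist R₁ R₀ _ (B5Ineq137Torus.T_symm P 0 x₂ x₁)

/-- **the big-block hull `bbHull (L^kL^s) X` is a union of `k`-blocks** (membership depends only on `⌊z_μ/(L^kL^s)⌋`, hence on `⌊z_μ/L^k⌋`; r01's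
`isBlockUnion_of_bigBlocks` with r18's `bbHull_bigBlock`). [cite: BalabanImbrieJaffe1988, (2.27) p.263] -/
theorem isBlockUnion_bbHull {k s : ℕ} (hk : 0 + k ≤ P.m + P.K) (X : Finset (Balaban1983to89.Site P 0)) :
    IsBlockUnion k (bbHull (P.L ^ k * P.L ^ s) X) :=
  isBlockUnion_of_bigBlocks (s := s) hk fun z z' h => bbHull_bigBlock _ X z z' h

/-- the big-block cube family `cubeFamB` (hulls of p29's cubes, `b = L^kL^s`) consists of `k`-block unions — the hypothesis `hcube` of p31's
`Z49_gen` (Hermitian symmetry of `Δ_{k,loc}`). [cite: BalabanImbrieJaffe1988, (2.27) p.263] -/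
theorem isBlockUnion_cubeFamB (hPd : P.d = d + 1) {k s : ℕ} (hk : 0 + k ≤ P.m + P.K) (c M0 : Fin (d + 1) → ℕ) (sg W : ℕ)
    (α : ↥(labels (P.L ^ k) M0 sg)) : IsBlockUnion k (cubeFamB hPd (P.L ^ k) c M0 sg W (P.L ^ k * P.L ^ s) α) :=
  isBlockUnion_bbHull hk _

end Glue

/-! ## §3 The five row hypotheses of the `_gen` members for a `k`-site whose block lies deep inside the reference box -/

section Rows

variable {d : ℕ}

/-- kernel: a deeper chart margin implies a shallower one. [folklore] -/
private theorem depth_mono (hPd : P.d = d + 1) {n : ℕ} {c M0 : Fin (d + 1) → ℕ} {D D' : ℝ} (hDD : D ≤ D')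
    {x : Balaban1983to89.Site P 0}
    (hdeep : ∀ i, D' ≤ (boxCoord hPd n c x i : ℝ) ∧ (boxCoord hPd n c x i : ℝ) + D' ≤ (n * M0 i : ℕ) - 1) :
    ∀ i, D ≤ (boxCoord hPd n c x i : ℝ) ∧ (boxCoord hPd n c x i : ℝ) + D ≤ (n * M0 i : ℕ) - 1 :=
  fun i => ⟨hDD.trans (hdeep i).1, by linarith [(hdeep i).2]⟩

/-- **THE ROW HYPOTHESES OF p31's `_gen` MEMBERS FOR A DEEP `k`-SITE** (print's *"for dist({x₁,x₂},Ω^c) > O(r(e_k))"*, located): if the block of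
`y₁ ∈ T^{(k)}` lies in `Ω₀ = c·L^k + Π_i[0, L^kM₀_i)` with chart margin `R₀ + R` (`R > ρ`, `0 ≤ R₁ < R₀`, torus gap `≥ R`, half-width
`W ≥ 2s_g/3 + R₀/2 + R`), then on every fine row `x` of the block: (o) `x ∈ T^{(0)}`; (i) `ζ″(x,y) ≠ 0 ⇒ Σ_α λ_α(x,y) = 1`; (ii″) an active pair has
`x` a `ρ`-deep row of `bbHull b □_α`, `y ∈ bbHull b □_α`, and every `w ∉ bbHull b □_α` at sup-torus distance `≥ R` from both; (iii)
`|x−y|_T ≤ R₁ ⇒ ζ″(x,y) = 1`; and the labels active on the block number `≤ (⌊(L^k − 1 + R₀)/s_g⌋ + 3)^{d+1}` — p29's `rowHyp_i`/`rowHyp_iii`/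
`card_activeLabels_le`/`mem_activeLabels_of_ne_zero_of_deep` and r18's `rowHyp_ii_hull` BY NAME. [cite: BalabanImbrieJaffe1988, (2.35) p.263] -/
theorem rows_of_deep (hPd : P.d = d + 1) {k sg W : ℕ} {c M0 : Fin (d + 1) → ℕ} (hk : 0 + k ≤ P.m + P.K) (hn : 1 ≤ P.L ^ k)
    (hsg : 0 < sg) (hfit0 : ∀ i, c i * P.L ^ k + P.L ^ k * M0 i ≤ P.sitesPerDir 0) {R R₀ R₁ ρ : ℝ} (hR : 0 ≤ R) (hR₁ : 0 ≤ R₁)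
    (hR10 : R₁ < R₀) (hρ : ρ < R) (hgap : ∀ i, ((P.L ^ k * M0 i : ℕ) : ℝ) + R ≤ P.sitesPerDir 0) (hW : 2 * (sg : ℝ) / 3 + R₀ / 2 + R ≤ W)
    (b : ℕ) {y₁ : Balaban1983to89.Site P (0 + k)}
    (hdeepB : ∀ μ, (c (Fin.cast hPd μ) : ℝ) * P.L ^ k + (R₀ + R) ≤ (P.L : ℝ) ^ k * (y₁ μ).val ∧
      (P.L : ℝ) ^ k * (y₁ μ).val + P.L ^ k + (R₀ + R) ≤ (c (Fin.cast hPd μ) : ℝ) * P.L ^ k + (P.L : ℝ) ^ k * M0 (Fin.cast hPd μ)) :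
    (∀ x ∈ blockK k y₁, x ∈ (univ : Finset (Balaban1983to89.Site P 0))) ∧
    (∀ x ∈ blockK k y₁, ∀ y, cutoff R₁ R₀ (B5Ineq137Torus.T P 0) x y ≠ 0 → ∑ α, lamFam hPd (P.L ^ k) c M0 sg α x y = 1) ∧
    (∀ x ∈ blockK k y₁, ∀ (α : ↥(labels (P.L ^ k) M0 sg)) (y : Balaban1983to89.Site P 0),
      cutoff R₁ R₀ (B5Ineq137Torus.T P 0) x y * lamFam hPd (P.L ^ k) c M0 sg α x y ≠ 0 →
        x ∈ deepRows ρ (cubeFamB hPd (P.L ^ k) c M0 sg W b α) ∧ y ∈ cubeFamB hPd (P.L ^ k) c M0 sg W b α ∧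
          ∀ w, w ∉ cubeFamB hPd (P.L ^ k) c M0 sg W b α → R ≤ B5Ineq137Torus.T P 0 x w ∧ R ≤ B5Ineq137Torus.T P 0 y w) ∧
    (∀ x ∈ blockK k y₁, ∀ y, B5Ineq137Torus.T P 0 x y ≤ R₁ → cutoff R₁ R₀ (B5Ineq137Torus.T P 0) x y = 1) ∧
    ∃ S : Finset ↥(labels (P.L ^ k) M0 sg), S.card ≤ (⌊(((P.L : ℝ) ^ k) - 1 + R₀) / sg⌋₊ + 3) ^ (d + 1) ∧
      ∀ x ∈ blockK k y₁, ∀ (α : ↥(labels (P.L ^ k) M0 sg)) (y : Balaban1983to89.Site P 0),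
        cutoff R₁ R₀ (B5Ineq137Torus.T P 0) x y * lamFam hPd (P.L ^ k) c M0 sg α x y ≠ 0 → α ∈ S := by
  have hR₀ : 0 ≤ R₀ := hR₁.trans hR10.le
  have hζ0 := cutoff_eq_zero_of_le (P := P) hR10
  have hxdeep := fun x (hx : x ∈ blockK k y₁) => mem_and_depth_of_mem_blockK hPd hk hfit0 (by linarith : 0 ≤ R₀ + R) hdeepB hx
  have hxdeep₀ := fun x (hx : x ∈ blockK k y₁) => depth_mono hPd (show R₀ ≤ R₀ + R by linarith) (hxdeep x hx).2
  refine ⟨fun x _ => mem_univ x, fun x hx => rowHyp_i hPd hfit0 hζ0 (hxdeep x hx).1 (hxdeep₀ x hx),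
    fun x hx => rowHyp_ii_hull hPd hn hsg hfit0 hR hR₀ hρ hgap hW b hζ0 (hxdeep x hx).1 (hxdeep x hx).2,
    fun x _ => rowHyp_iii hR10 x, ?_⟩
  refine ⟨(activeLabels hPd (P.L ^ k) c sg R₀ y₁).subtype fun α => α ∈ labels (P.L ^ k) M0 sg, ?_, ?_⟩
  · have h1 : ((activeLabels hPd (P.L ^ k) c sg R₀ y₁).subtype fun α => α ∈ labels (P.L ^ k) M0 sg).card ≤
        (activeLabels hPd (P.L ^ k) c sg R₀ y₁).card := by
      rw [Finset.card_subtype]; exact Finset.card_filter_le _ _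
    have h2 := card_activeLabels_le (hPd := hPd) (c := c) (R₀ := R₀) hn hsg hR₀ y₁
    have e1 : (((P.L ^ k : ℕ) : ℕ) : ℝ) = (P.L : ℝ) ^ k := by push_cast; rfl
    rw [e1] at h2
    exact h1.trans h2
  · intro x hx α y hne
    rw [Finset.mem_subtype]
    exact mem_activeLabels_of_ne_zero_of_deep hk hsg hfit0 hζ0 hx (hxdeep₀ x hx) hne

end Rows

/-! ## §4 (2.38) for `Δ_{k,loc}(u)` at a (2.23)-regular background, for the printed torus data with big-block cubes -/

section Member238

variable {d : ℕ}

/-- **(2.38) FOR `Δ_{k,loc}(u)`, `Ω = T_η`, AT A (2.23)-REGULAR NON-FLAT BACKGROUND `u = e^{ieεA}`, FOR THE PRINTED LOCALIZATION DATA WITH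
BIG-BLOCK CUBES** (p. 264: *"Finally, in view of (2.35), the lower bound (I.7.3.2) applies to Δ_{k,loc}(u) as well. Let φ be supported in a
region having an r(e_k) neighborhood where u is smooth. Then ⟨φ, Δ_{k,loc}(u)φ⟩ ≧ c₁Σ_b|u(b)φ(b₊) − φ(b₋)|² − ce_k²p(e_k)²Σ_x|φ(x)|². (2.38)"*).  For `d + 1` directions, `L ≥ 2`, `a > 0`, `e`, `(c, β)`: `∃ s₀`, `∀ s ≥ s₀`, `∃ c₀, e₁ > 0` (from
`(d, L, a, e, c, β, s)` only) such that on every torus of the series, at every level `1 ≤ k ≤ K` with `k + s ≤ m + K`, `3L^kL^s ≤ |T^{(0)}|`, for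
every `A` (2.23)-regular on `T^{(0)}` (`0 < e_k ≤ e₁`), every reference no-wrap box `Ω₀ = c·L^k + Π_i[0, L^kM₀_i)` with torus gap `≥ R`, spacing
`s_g ≥ 1`, half-width `W ≥ 2s_g/3 + R₀/2 + R`, radii `R > rowMargin`, `0 ≤ R₁ < R₀`, every set `Λ` of `k`-sites whose blocks lie in `Ω₀` with chart
margin `R₀ + R`, and every `φ` supported in `Λ`:
`(A/a_k)·[γ₀·Σ_b‖u_k(b)φ(b₊) − φ(b₋)‖² − ((4/3)d′⁴(2c·e_k^β)² + a_k²·c₀e^{δ₀/2}K_{d′}(δ₀/2)·(m·e^{−2δ₀R/L^k} + e^{−(δ₀/2)R₁/L^k}))·Σ_y‖φ(y)‖²]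
≤ Re⟨φ, Δ_{k,loc}(u)φ⟩`, `γ₀ = min(a/(9d′), 1/12)`, `δ₀ = 1/(8L^s)`, `m = (⌊(L^k − 1 + R₀)/s_g⌋ + 3)^{d+1}`, `d′ = d + 1`, `A = α_kL^{kd′}`,
`u_k = lineIter u k` — p31 v1.1's `ineq238_gen` BY NAME (`Ω = X₀ = T^{(0)}`, `X_α` = the `rowMargin`-deep rows of the hulls), its (7.3.2) input
this seat's `ineq238_deltaRegion_smallField_region` with the plaquette size `2c·e_k^β/L^{2k}` of §1, the (H1.10)/(H1.12″) inputs r18's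
`inputs_regular`, the rows §3. [cite: BalabanImbrieJaffe1988, (2.38) p.264] -/
theorem ineq238_regular_torus_cwt (d L : ℕ) (hL : 2 ≤ L) {a : ℝ} (ha : 0 < a) (e creg β : ℝ) (hcreg : 0 ≤ creg) (hβ : 0 < β) :
    ∃ s₀ : ℕ, ∀ s : ℕ, s₀ ≤ s → ∃ c₀ e₁ : ℝ, 0 < c₀ ∧ 0 < e₁ ∧
      ∀ (P : Params) (hPd : P.d = d + 1), P.L = L → ∀ (k : ℕ), 1 ≤ k → k ≤ P.K → k + s ≤ P.m + P.K →
      3 * (L ^ k * L ^ s) ≤ P.sitesPerDir 0 →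
      ∀ (A : PBond P 0 → ℝ) (ec : ℝ), 0 < ec → ec ≤ e₁ →
      (∀ (z : Balaban1983to89.Site P 0) (μ ν : Fin P.d),
          P.spacing k * |e| / ec * |A ⟨z.shift μ, ν⟩ - A ⟨z, ν⟩| ≤ creg * ec ^ (β - 1) / (L : ℝ) ^ k) →
      ∀ (c M0 : Fin (d + 1) → ℕ), (∀ i, c i * P.L ^ k + P.L ^ k * M0 i ≤ P.sitesPerDir 0) →
      ∀ (sg W : ℕ), 1 ≤ sg → ∀ (R R₀ R₁ : ℝ), ((rowMargin L (d + 1) k s : ℕ) : ℝ) < R → 0 ≤ R₁ → R₁ < R₀ →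
        2 * (sg : ℝ) / 3 + R₀ / 2 + R ≤ W → (∀ i, ((P.L ^ k * M0 i : ℕ) : ℝ) + R ≤ P.sitesPerDir 0) →
      ∀ (Λ : Finset (Balaban1983to89.Site P (0 + k))),
        (∀ y₁ ∈ Λ, ∀ μ, (c (Fin.cast hPd μ) : ℝ) * P.L ^ k + (R₀ + R) ≤ (P.L : ℝ) ^ k * (y₁ μ).val ∧
          (P.L : ℝ) ^ k * (y₁ μ).val + P.L ^ k + (R₀ + R) ≤ (c (Fin.cast hPd μ) : ℝ) * P.L ^ k + (P.L : ℝ) ^ k * M0 (Fin.cast hPd μ)) →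
      ∀ (φ : Balaban1983to89.Site P (0 + k) → ℂ), (∀ y ∉ Λ, φ y = 0) →
        (B1RG242Torus.α P a k * (P.L : ℝ) ^ (k * P.d)) / B1.aSeq a P.L k *
            (min (a / (9 * (P.d + 1))) (1 / 12) *
                ∑ b : PBond P (0 + k), ‖toC (lineIter (expGauge P e A) k b) * φ b.tgt - φ b.src‖ ^ 2
              - (4 / 3 * (P.d : ℝ) ^ 4 * (2 * creg * ec ^ β) ^ 2 +
                  B1.aSeq a P.L k ^ 2 * (c₀ * Real.exp (1 / (8 * (L : ℝ) ^ s) / 2) * latticeConst P.d (1 / (8 * (L : ℝ) ^ s) / 2)) *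
                    ((((⌊(((P.L : ℝ) ^ k) - 1 + R₀) / sg⌋₊ : ℝ) + 3) ^ (d + 1)) *
                        Real.exp (-(1 / (8 * (L : ℝ) ^ s) * (((P.L : ℝ) ^ k)⁻¹ * (2 * R)))) +
                      Real.exp (-(1 / (8 * (L : ℝ) ^ s) / 2 * (((P.L : ℝ) ^ k)⁻¹ * R₁))))) *
                ∑ y : Balaban1983to89.Site P (0 + k), ‖φ y‖ ^ 2)
          ≤ (star φ ⬝ᵥ (deltaLocT (B1RG242Torus.α P a k * (P.L : ℝ) ^ (k * P.d)) P.eps⁻¹ (expGauge P e A) k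
              (cubeFamB hPd (P.L ^ k) c M0 sg W (L ^ k * L ^ s)) (lamFam hPd (P.L ^ k) c M0 sg)
              (cutoff R₁ R₀ (B5Ineq137Torus.T P 0)) *ᵥ φ)).re := by
  obtain ⟨s₀, H⟩ := inputs_regular (d + 1) L (Nat.succ_pos d) hL ha e creg β hcreg hβ
  refine ⟨s₀, fun s hs => ?_⟩
  obtain ⟨c₀, e₁, hc₀, he₁, I⟩ := H s hs
  refine ⟨c₀, e₁, hc₀, he₁, ?_⟩
  intro P hPd hPL k hk1 hkK hks hsize A ec hec hece hreg c M0 hfit0 sg W hsg R R₀ R₁ hRm hR₁ hR10 hW hgap Λ hΛ φ hφ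
  obtain ⟨I1, -, I3⟩ := I P hPd hPL hk1 hkK hks hsize A hec hece hreg
  subst hPL
  have hn : 1 ≤ P.L ^ k := Nat.one_le_pow _ _ P.L_pos
  have hk : 0 + k ≤ P.m + P.K := by omega
  have hR : 0 ≤ R := le_trans (Nat.cast_nonneg _) hRm.le
  have hLs : (0 : ℝ) < (P.L : ℝ) ^ s := pow_pos P.cast_L_pos s
  have hδ₀ : (0 : ℝ) < 1 / (8 * (P.L : ℝ) ^ s) := div_pos one_pos (mul_pos (by norm_num) hLs)
  have hθ := fun x μ ν => norm_plaqC_expGauge_sub_one_le_of_regular (k := k) hec hreg x μ ν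
  have h := ineq238_gen hk1 hk ha (expGauge P e A) hθ (isBlockUnion_univ k) univ
    (cubeFamB hPd (P.L ^ k) c M0 sg W (P.L ^ k * P.L ^ s))
    (fun α => deepRows ((rowMargin P.L (d + 1) k s : ℕ) : ℝ) (cubeFamB hPd (P.L ^ k) c M0 sg W (P.L ^ k * P.L ^ s) α))
    (lam := lamFam hPd (P.L ^ k) c M0 sg) (ζ'' := cutoff R₁ R₀ (B5Ineq137Torus.T P 0))
    (sum_abs_lamT_le_one hfit0) (cutoff_mem_unitInterval R₁ R₀) hδ₀ hc₀.le I1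
    (fun α x hx f F D Db Df hF hfB hD hsD hDb hsDb hDf hsDf =>
      I3 (cubeFamB hPd (P.L ^ k) c M0 sg W (P.L ^ k * P.L ^ s) α) (bbHull_bigBlock _ _) x hx f F D Db Df hF hfB hD hsD hDb hsDb hDf hsDf)
    hR ((⌊(((P.L : ℝ) ^ k) - 1 + R₀) / sg⌋₊ + 3) ^ (d + 1)) (fun ψ => ∀ y ∉ Λ, ψ y = 0)
    (fun ψ hψ y₁ hy₁ => rows_of_deep hPd hk hn hsg hfit0 hR hR₁ hR10 hRm hgap hW _
      (hΛ y₁ (by by_contra h'; exact hy₁ (hψ y₁ h'))))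
    (fun ψ _ b _ => by rw [starB_innerK_univ]; exact mem_univ _) φ hφ
  rw [fieldStrength_sq_regular] at h
  refine le_trans (le_of_eq ?_) h
  push_cast
  ring

end Member238

/-! ## §5 (2.40) and (4.9)_{j≥1} for `Δ_{k,loc}(u)` at a (2.23)-regular background, for the printed torus data with big-block cubes -/

section Member240

variable {d : ℕ}

/-- **(2.40) AND (4.9)_{j≥1} FOR `Δ_{k,loc}(u)`, `Ω = T_η`, AT A (2.23)-REGULAR NON-FLAT BACKGROUND `u = e^{ieεA}`, FOR THE PRINTED DATA WITH
BIG-BLOCK CUBES** (p. 264: *"We define C^{(k)}_Λ(u) = [(Δ_{k,loc}(u) + aL^{−2}Q(u_k)^*Q(u_k))|_Λ]^{−1}. (2.40) This is of course a nonlocal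
operator, but by (2.38), C^{(k)}_Λ(u)^{−1} is bounded below"*; p. 275 (4.9): the Gaussian normalization `Z^{(j)}_Λ`, `j ≥ 1`).  With the data and hypotheses of `ineq238_regular_torus_cwt` and
`k + 1 ≤ m + K`, for every `Λ` of `k`-sites whose blocks lie in `Ω₀` with chart margin `R₀ + R`, every smallness `(T₁, δ′, σ)` of the averaged
field `u_k = lineIter u k` inside the `L`-blocks of `T^{(k)}` (`‖u_k(b) − 1‖ ≤ T₁` on intra-block bonds, `‖u_k(Γ_{yx}) − 1‖ ≤ δ′`,
`2(L−1)L·d′·T₁² + 2δ′² ≤ σ` — [I] (4.5.4) shape), every `κ′ ≥ 0` and the largeness condition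
`E := (4/3)d′⁴(2c·e_k^β)² + a_k²c₀e^{δ₀/2}K_{d′}(δ₀/2)(m·e^{−2δ₀R/L^k} + e^{−(δ₀/2)R₁/L^k}) < c240(γ₀, κ′)·(1 − σ)` (print's *"by (2.38) … bounded
below"*, located: radii `≫ L^k`, `e_k` small), for all `E_s, N`: the realified precision matrix `realify((Δ_{k,loc}(u) + (A/a_k)κ′P(u_k))|_Λ)` IS
POSITIVE DEFINITE, `Z^{(k)}_Λ = e^{−E_sN}(2π)^{#(Λ×2)/2}/√det(…)` and `Z^{(k)}_Λ > 0` — p31 v1.1's `Z49_gen` BY NAME (symmetry of the data §2, rows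
§3, inputs r18 §3, plaquettes §1). [cite: BalabanImbrieJaffe1988, (2.40) p.264] [cite: BalabanImbrieJaffe1988, (4.9) p.275] -/
theorem Z49_regular_torus_cwt (d L : ℕ) (hL : 2 ≤ L) {a : ℝ} (ha : 0 < a) (e creg β : ℝ) (hcreg : 0 ≤ creg) (hβ : 0 < β) :
    ∃ s₀ : ℕ, ∀ s : ℕ, s₀ ≤ s → ∃ c₀ e₁ : ℝ, 0 < c₀ ∧ 0 < e₁ ∧
      ∀ (P : Params) (hPd : P.d = d + 1), P.L = L → ∀ (k : ℕ), 1 ≤ k → k ≤ P.K → k + s ≤ P.m + P.K → k + 1 ≤ P.m + P.K →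
      3 * (L ^ k * L ^ s) ≤ P.sitesPerDir 0 →
      ∀ (A : PBond P 0 → ℝ) (ec : ℝ), 0 < ec → ec ≤ e₁ →
      (∀ (z : Balaban1983to89.Site P 0) (μ ν : Fin P.d),
          P.spacing k * |e| / ec * |A ⟨z.shift μ, ν⟩ - A ⟨z, ν⟩| ≤ creg * ec ^ (β - 1) / (L : ℝ) ^ k) →
      ∀ (c M0 : Fin (d + 1) → ℕ), (∀ i, c i * P.L ^ k + P.L ^ k * M0 i ≤ P.sitesPerDir 0) →
      ∀ (sg W : ℕ), 1 ≤ sg → ∀ (R R₀ R₁ : ℝ), ((rowMargin L (d + 1) k s : ℕ) : ℝ) < R → 0 ≤ R₁ → R₁ < R₀ →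
        2 * (sg : ℝ) / 3 + R₀ / 2 + R ≤ W → (∀ i, ((P.L ^ k * M0 i : ℕ) : ℝ) + R ≤ P.sitesPerDir 0) →
      ∀ (Λ : Finset (Balaban1983to89.Site P (0 + k))),
        (∀ y₁ ∈ Λ, ∀ μ, (c (Fin.cast hPd μ) : ℝ) * P.L ^ k + (R₀ + R) ≤ (P.L : ℝ) ^ k * (y₁ μ).val ∧
          (P.L : ℝ) ^ k * (y₁ μ).val + P.L ^ k + (R₀ + R) ≤ (c (Fin.cast hPd μ) : ℝ) * P.L ^ k + (P.L : ℝ) ^ k * M0 (Fin.cast hPd μ)) →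
      ∀ (T₁ δ' σ : ℝ),
        (∀ b : PBond P (0 + k), blkIter 1 b.src = blkIter 1 b.tgt → ‖toC (lineIter (expGauge P e A) k b) - 1‖ ≤ T₁) →
        (∀ y : Balaban1983to89.Site P (0 + k), ‖holCK (lineIter (expGauge P e A) k) 1 y - 1‖ ≤ δ') →
        2 * (((P.L : ℝ) - 1) * P.L) * P.d * T₁ ^ 2 + 2 * δ' ^ 2 ≤ σ →
      ∀ (κ' : ℝ), 0 ≤ κ' →
        4 / 3 * (P.d : ℝ) ^ 4 * (2 * creg * ec ^ β) ^ 2 +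
            B1.aSeq a P.L k ^ 2 * (c₀ * Real.exp (1 / (8 * (L : ℝ) ^ s) / 2) * latticeConst P.d (1 / (8 * (L : ℝ) ^ s) / 2)) *
              ((((⌊(((P.L : ℝ) ^ k) - 1 + R₀) / sg⌋₊ : ℝ) + 3) ^ (d + 1)) *
                  Real.exp (-(1 / (8 * (L : ℝ) ^ s) * (((P.L : ℝ) ^ k)⁻¹ * (2 * R)))) +
                Real.exp (-(1 / (8 * (L : ℝ) ^ s) / 2 * (((P.L : ℝ) ^ k)⁻¹ * R₁)))) <
          c240 P (min (a / (9 * (P.d + 1))) (1 / 12)) κ' * (1 - σ) →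
      ∀ (Es N : ℝ),
        (realify (compress Λ (op240 (deltaLocT (B1RG242Torus.α P a k * (P.L : ℝ) ^ (k * P.d)) P.eps⁻¹ (expGauge P e A) k
            (cubeFamB hPd (P.L ^ k) c M0 sg W (L ^ k * L ^ s)) (lamFam hPd (P.L ^ k) c M0 sg) (cutoff R₁ R₀ (B5Ineq137Torus.T P 0)))
            ((B1RG242Torus.α P a k * (P.L : ℝ) ^ (k * P.d)) / B1.aSeq a P.L k * κ') (lineIter (expGauge P e A) k)))).PosDef ∧
        Z49 (realify (compress Λ (op240 (deltaLocT (B1RG242Torus.α P a k * (P.L : ℝ) ^ (k * P.d)) P.eps⁻¹ (expGauge P e A) k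
            (cubeFamB hPd (P.L ^ k) c M0 sg W (L ^ k * L ^ s)) (lamFam hPd (P.L ^ k) c M0 sg) (cutoff R₁ R₀ (B5Ineq137Torus.T P 0)))
            ((B1RG242Torus.α P a k * (P.L : ℝ) ^ (k * P.d)) / B1.aSeq a P.L k * κ') (lineIter (expGauge P e A) k)))) Es N =
          Real.exp (-(Es * N)) * (Real.sqrt (2 * Real.pi) ^ Fintype.card (↥Λ × Fin 2) /
            Real.sqrt (realify (compress Λ (op240 (deltaLocT (B1RG242Torus.α P a k * (P.L : ℝ) ^ (k * P.d)) P.eps⁻¹ (expGauge P e A) k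
              (cubeFamB hPd (P.L ^ k) c M0 sg W (L ^ k * L ^ s)) (lamFam hPd (P.L ^ k) c M0 sg) (cutoff R₁ R₀ (B5Ineq137Torus.T P 0)))
              ((B1RG242Torus.α P a k * (P.L : ℝ) ^ (k * P.d)) / B1.aSeq a P.L k * κ') (lineIter (expGauge P e A) k)))).det) ∧
        0 < Z49 (realify (compress Λ (op240 (deltaLocT (B1RG242Torus.α P a k * (P.L : ℝ) ^ (k * P.d)) P.eps⁻¹ (expGauge P e A) k
            (cubeFamB hPd (P.L ^ k) c M0 sg W (L ^ k * L ^ s)) (lamFam hPd (P.L ^ k) c M0 sg) (cutoff R₁ R₀ (B5Ineq137Torus.T P 0)))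
            ((B1RG242Torus.α P a k * (P.L : ℝ) ^ (k * P.d)) / B1.aSeq a P.L k * κ') (lineIter (expGauge P e A) k)))) Es N := by
  obtain ⟨s₀, H⟩ := inputs_regular (d + 1) L (Nat.succ_pos d) hL ha e creg β hcreg hβ
  refine ⟨s₀, fun s hs => ?_⟩
  obtain ⟨c₀, e₁, hc₀, he₁, I⟩ := H s hs
  refine ⟨c₀, e₁, hc₀, he₁, ?_⟩
  intro P hPd hPL k hk1 hkK hks hk' hsize A ec hec hece hreg c M0 hfit0 sg W hsg R R₀ R₁ hRm hR₁ hR10 hW hgap Λ hΛ T₁ δ' σ hInt hTree hσ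
    κ' hκ' hE Es N
  obtain ⟨I1, -, I3⟩ := I P hPd hPL hk1 hkK hks hsize A hec hece hreg
  subst hPL
  have hn : 1 ≤ P.L ^ k := Nat.one_le_pow _ _ P.L_pos
  have hk : 0 + k ≤ P.m + P.K := by omega
  have hk'' : 0 + k + 1 ≤ P.m + P.K := by omega
  have hR : 0 ≤ R := le_trans (Nat.cast_nonneg _) hRm.le
  have hLs : (0 : ℝ) < (P.L : ℝ) ^ s := pow_pos P.cast_L_pos s
  have hδ₀ : (0 : ℝ) < 1 / (8 * (P.L : ℝ) ^ s) := div_pos one_pos (mul_pos (by norm_num) hLs)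
  have hθ := fun x μ ν => norm_plaqC_expGauge_sub_one_le_of_regular (k := k) hec hreg x μ ν
  rw [← fieldStrength_sq_regular (P := P) k creg β ec] at hE
  have h := Z49_gen hk1 hk'' ha (expGauge P e A) hθ (isBlockUnion_univ k) univ
    (cube := cubeFamB hPd (P.L ^ k) c M0 sg W (P.L ^ k * P.L ^ s)) (isBlockUnion_cubeFamB hPd hk c M0 sg W)
    (fun α => deepRows ((rowMargin P.L (d + 1) k s : ℕ) : ℝ) (cubeFamB hPd (P.L ^ k) c M0 sg W (P.L ^ k * P.L ^ s) α))
    (lam := lamFam hPd (P.L ^ k) c M0 sg) (ζ'' := cutoff R₁ R₀ (B5Ineq137Torus.T P 0))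
    (sum_abs_lamT_le_one hfit0) (fun α x₁ x₂ => lamFam_symm hPd (P.L ^ k) c M0 sg α x₁ x₂) (cutoff_mem_unitInterval R₁ R₀)
    (cutoff_T_symm R₁ R₀) hδ₀ hc₀.le I1
    (fun α x hx f F D Db Df hF hfB hD hsD hDb hsDb hDf hsDf =>
      I3 (cubeFamB hPd (P.L ^ k) c M0 sg W (P.L ^ k * P.L ^ s) α) (bbHull_bigBlock _ _) x hx f F D Db Df hF hfB hD hsD hDb hsDb hDf hsDf)
    hR ((⌊(((P.L : ℝ) ^ k) - 1 + R₀) / sg⌋₊ + 3) ^ (d + 1)) Λ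
    (fun y₁ hy₁ => rows_of_deep hPd hk hn hsg hfit0 hR hR₁ hR10 hRm hgap hW _ (hΛ y₁ hy₁))
    (fun b _ => by rw [starB_innerK_univ]; exact mem_univ _) hInt hTree hσ hκ' (by push_cast at hE ⊢; exact hE) Es N
  exact h

end Member240

/-! ## §6 (2.41) for `C^{(k)}_Λ(u)` at a (2.23)-regular background, for the printed torus data with big-block cubes -/

section Member241

variable {d : ℕ}

/-- **(2.41) FOR `C^{(k)}_Λ(u) = [(Δ_{k,loc}(u) + (A/a_k)κ′P(u_k))|_Λ]^{−1}`, `Ω = T_η`, AT A (2.23)-REGULAR NON-FLAT BACKGROUND `u = e^{ieεA}`, FOR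
THE PRINTED DATA WITH BIG-BLOCK CUBES** (p. 264: *"a random walk expansion as in [6] can be used to prove that |C^{(k)}_Λ(u; x₁, x₂)| ≦
ce^{−c|x₁−x₂|}. (2.41)"*).  With the data and hypotheses of `Z49_regular_torus_cwt` (regular `A`, reference box, radii, deep `Λ`, averaged-field
smallness `(T₁, δ′, σ)`, `κ′ ≥ 0`, `E < c240(γ₀,κ′)(1−σ)`) and a decay rate `0 ≤ ϑ ≤ δ₀/4` with
`ϑ·(4/δ₀)(2K_{d′}(δ₀/2))·(a_k(1 + m·a_kc₀e^{δ₀}) + κ′L^{−2d′}e^{δ₀(L−1)}) ≤ (c240(γ₀,κ′)(1−σ) − E)/2`: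
**`‖C^{(k)}_Λ(u; x₁, x₂)‖ ≤ (A/a_k)^{−1}·(4/(c240(γ₀,κ′)(1−σ) − E))·e^{−ϑ|x₁−x₂|_{T^{(k)}}}`** for all `x₁, x₂ ∈ Λ` — p31 v1.1's `decay241_gen` BY NAME
(its (H1.10″) input for the cubes = r18's `inputs_regular` second member), uniformly in the torus and `Λ`. [cite: BalabanImbrieJaffe1988, (2.41) p.264] -/
theorem decay241_regular_torus_cwt (d L : ℕ) (hL : 2 ≤ L) {a : ℝ} (ha : 0 < a) (e creg β : ℝ) (hcreg : 0 ≤ creg) (hβ : 0 < β) :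
    ∃ s₀ : ℕ, ∀ s : ℕ, s₀ ≤ s → ∃ c₀ e₁ : ℝ, 0 < c₀ ∧ 0 < e₁ ∧
      ∀ (P : Params) (hPd : P.d = d + 1), P.L = L → ∀ (k : ℕ), 1 ≤ k → k ≤ P.K → k + s ≤ P.m + P.K → k + 1 ≤ P.m + P.K →
      3 * (L ^ k * L ^ s) ≤ P.sitesPerDir 0 →
      ∀ (A : PBond P 0 → ℝ) (ec : ℝ), 0 < ec → ec ≤ e₁ →
      (∀ (z : Balaban1983to89.Site P 0) (μ ν : Fin P.d),
          P.spacing k * |e| / ec * |A ⟨z.shift μ, ν⟩ - A ⟨z, ν⟩| ≤ creg * ec ^ (β - 1) / (L : ℝ) ^ k) →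
      ∀ (c M0 : Fin (d + 1) → ℕ), (∀ i, c i * P.L ^ k + P.L ^ k * M0 i ≤ P.sitesPerDir 0) →
      ∀ (sg W : ℕ), 1 ≤ sg → ∀ (R R₀ R₁ : ℝ), ((rowMargin L (d + 1) k s : ℕ) : ℝ) < R → 0 ≤ R₁ → R₁ < R₀ →
        2 * (sg : ℝ) / 3 + R₀ / 2 + R ≤ W → (∀ i, ((P.L ^ k * M0 i : ℕ) : ℝ) + R ≤ P.sitesPerDir 0) →
      ∀ (Λ : Finset (Balaban1983to89.Site P (0 + k))),
        (∀ y₁ ∈ Λ, ∀ μ, (c (Fin.cast hPd μ) : ℝ) * P.L ^ k + (R₀ + R) ≤ (P.L : ℝ) ^ k * (y₁ μ).val ∧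
          (P.L : ℝ) ^ k * (y₁ μ).val + P.L ^ k + (R₀ + R) ≤ (c (Fin.cast hPd μ) : ℝ) * P.L ^ k + (P.L : ℝ) ^ k * M0 (Fin.cast hPd μ)) →
      ∀ (T₁ δ' σ : ℝ),
        (∀ b : PBond P (0 + k), blkIter 1 b.src = blkIter 1 b.tgt → ‖toC (lineIter (expGauge P e A) k b) - 1‖ ≤ T₁) →
        (∀ y : Balaban1983to89.Site P (0 + k), ‖holCK (lineIter (expGauge P e A) k) 1 y - 1‖ ≤ δ') →
        2 * (((P.L : ℝ) - 1) * P.L) * P.d * T₁ ^ 2 + 2 * δ' ^ 2 ≤ σ →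
      ∀ (κ' : ℝ), 0 ≤ κ' →
        4 / 3 * (P.d : ℝ) ^ 4 * (2 * creg * ec ^ β) ^ 2 +
            B1.aSeq a P.L k ^ 2 * (c₀ * Real.exp (1 / (8 * (L : ℝ) ^ s) / 2) * latticeConst P.d (1 / (8 * (L : ℝ) ^ s) / 2)) *
              ((((⌊(((P.L : ℝ) ^ k) - 1 + R₀) / sg⌋₊ : ℝ) + 3) ^ (d + 1)) *
                  Real.exp (-(1 / (8 * (L : ℝ) ^ s) * (((P.L : ℝ) ^ k)⁻¹ * (2 * R)))) +
                Real.exp (-(1 / (8 * (L : ℝ) ^ s) / 2 * (((P.L : ℝ) ^ k)⁻¹ * R₁)))) <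
          c240 P (min (a / (9 * (P.d + 1))) (1 / 12)) κ' * (1 - σ) →
      ∀ (ϑ : ℝ), 0 ≤ ϑ → ϑ ≤ 1 / (8 * (L : ℝ) ^ s) / 4 →
        ϑ * ((4 / (1 / (8 * (L : ℝ) ^ s))) * (2 * latticeConst P.d (1 / (8 * (L : ℝ) ^ s) / 2)) *
            (B1.aSeq a P.L k * (1 + (((⌊(((P.L : ℝ) ^ k) - 1 + R₀) / sg⌋₊ : ℝ) + 3) ^ (d + 1)) * B1.aSeq a P.L k *
                (c₀ * Real.exp (1 / (8 * (L : ℝ) ^ s)))) +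
              κ' * (((P.L : ℝ) ^ P.d)⁻¹) ^ 2 * Real.exp (1 / (8 * (L : ℝ) ^ s) * ((P.L : ℝ) - 1)))) ≤
          (c240 P (min (a / (9 * (P.d + 1))) (1 / 12)) κ' * (1 - σ) -
            (4 / 3 * (P.d : ℝ) ^ 4 * (2 * creg * ec ^ β) ^ 2 +
              B1.aSeq a P.L k ^ 2 * (c₀ * Real.exp (1 / (8 * (L : ℝ) ^ s) / 2) * latticeConst P.d (1 / (8 * (L : ℝ) ^ s) / 2)) *
                ((((⌊(((P.L : ℝ) ^ k) - 1 + R₀) / sg⌋₊ : ℝ) + 3) ^ (d + 1)) *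
                    Real.exp (-(1 / (8 * (L : ℝ) ^ s) * (((P.L : ℝ) ^ k)⁻¹ * (2 * R)))) +
                  Real.exp (-(1 / (8 * (L : ℝ) ^ s) / 2 * (((P.L : ℝ) ^ k)⁻¹ * R₁)))))) / 2 →
      ∀ (x₁ x₂ : ↥Λ),
        ‖(compress Λ (op240 (deltaLocT (B1RG242Torus.α P a k * (P.L : ℝ) ^ (k * P.d)) P.eps⁻¹ (expGauge P e A) k
            (cubeFamB hPd (P.L ^ k) c M0 sg W (L ^ k * L ^ s)) (lamFam hPd (P.L ^ k) c M0 sg) (cutoff R₁ R₀ (B5Ineq137Torus.T P 0)))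
            ((B1RG242Torus.α P a k * (P.L : ℝ) ^ (k * P.d)) / B1.aSeq a P.L k * κ') (lineIter (expGauge P e A) k)))⁻¹ x₁ x₂‖ ≤
          ((B1RG242Torus.α P a k * (P.L : ℝ) ^ (k * P.d)) / B1.aSeq a P.L k)⁻¹ *
            (4 / (c240 P (min (a / (9 * (P.d + 1))) (1 / 12)) κ' * (1 - σ) -
              (4 / 3 * (P.d : ℝ) ^ 4 * (2 * creg * ec ^ β) ^ 2 +
                B1.aSeq a P.L k ^ 2 * (c₀ * Real.exp (1 / (8 * (L : ℝ) ^ s) / 2) * latticeConst P.d (1 / (8 * (L : ℝ) ^ s) / 2)) *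
                  ((((⌊(((P.L : ℝ) ^ k) - 1 + R₀) / sg⌋₊ : ℝ) + 3) ^ (d + 1)) *
                      Real.exp (-(1 / (8 * (L : ℝ) ^ s) * (((P.L : ℝ) ^ k)⁻¹ * (2 * R)))) +
                    Real.exp (-(1 / (8 * (L : ℝ) ^ s) / 2 * (((P.L : ℝ) ^ k)⁻¹ * R₁))))))) *
            Real.exp (-(ϑ * B5Ineq137Torus.T P (0 + k) x₁ x₂)) := by
  obtain ⟨s₀, H⟩ := inputs_regular (d + 1) L (Nat.succ_pos d) hL ha e creg β hcreg hβ
  refine ⟨s₀, fun s hs => ?_⟩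
  obtain ⟨c₀, e₁, hc₀, he₁, I⟩ := H s hs
  refine ⟨c₀, e₁, hc₀, he₁, ?_⟩
  intro P hPd hPL k hk1 hkK hks hk' hsize A ec hec hece hreg c M0 hfit0 sg W hsg R R₀ R₁ hRm hR₁ hR10 hW hgap Λ hΛ T₁ δ' σ hInt hTree hσ
    κ' hκ' hE ϑ hϑ0 hϑ hsmall x₁ x₂
  obtain ⟨I1, I2, I3⟩ := I P hPd hPL hk1 hkK hks hsize A hec hece hreg
  subst hPL
  have hn : 1 ≤ P.L ^ k := Nat.one_le_pow _ _ P.L_pos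
  have hk : 0 + k ≤ P.m + P.K := by omega
  have hk'' : 0 + k + 1 ≤ P.m + P.K := by omega
  have hR : 0 ≤ R := le_trans (Nat.cast_nonneg _) hRm.le
  have hLs : (0 : ℝ) < (P.L : ℝ) ^ s := pow_pos P.cast_L_pos s
  have hδ₀ : (0 : ℝ) < 1 / (8 * (P.L : ℝ) ^ s) := div_pos one_pos (mul_pos (by norm_num) hLs)
  have hθ := fun x μ ν => norm_plaqC_expGauge_sub_one_le_of_regular (k := k) hec hreg x μ ν
  rw [← fieldStrength_sq_regular (P := P) k creg β ec] at hE hsmall ⊢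
  have h := decay241_gen hk1 hk'' ha (expGauge P e A) hθ (isBlockUnion_univ k) univ
    (cubeFamB hPd (P.L ^ k) c M0 sg W (P.L ^ k * P.L ^ s))
    (fun α => deepRows ((rowMargin P.L (d + 1) k s : ℕ) : ℝ) (cubeFamB hPd (P.L ^ k) c M0 sg W (P.L ^ k * P.L ^ s) α))
    (lam := lamFam hPd (P.L ^ k) c M0 sg) (ζ'' := cutoff R₁ R₀ (B5Ineq137Torus.T P 0))
    (sum_abs_lamT_le_one hfit0) (cutoff_mem_unitInterval R₁ R₀) hδ₀ hc₀.le I1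
    (fun α x hx f F D hF hD hsD => I2 (cubeFamB hPd (P.L ^ k) c M0 sg W (P.L ^ k * P.L ^ s) α) (bbHull_bigBlock _ _) x hx f F D hF hD hsD)
    (fun α x hx f F D Db Df hF hfB hD hsD hDb hsDb hDf hsDf =>
      I3 (cubeFamB hPd (P.L ^ k) c M0 sg W (P.L ^ k * P.L ^ s) α) (bbHull_bigBlock _ _) x hx f F D Db Df hF hfB hD hsD hDb hsDb hDf hsDf)
    hR ((⌊(((P.L : ℝ) ^ k) - 1 + R₀) / sg⌋₊ + 3) ^ (d + 1)) Λ
    (fun y₁ hy₁ => rows_of_deep hPd hk hn hsg hfit0 hR hR₁ hR10 hRm hgap hW _ (hΛ y₁ hy₁))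
    (fun b _ => by rw [starB_innerK_univ]; exact mem_univ _) hInt hTree hσ hκ' (by push_cast at hE ⊢; exact hE) hϑ0 hϑ
    (by push_cast at hsmall ⊢; exact hsmall) x₁ x₂
  push_cast at h ⊢
  exact h

end Member241

/-! ## §7 The averaged-field smallness from a sup bound on `A` (*«A is smooth and small»*), and the corollaries -/

section SupBound

variable {d : ℕ}

/-- kernel: for factors of norm `≤ 1`, `‖Π_i z_i − 1‖ ≤ Σ_i ‖z_i − 1‖`. [folklore] -/
private theorem norm_prod_sub_one_le {ι : Type*} (s : Finset ι) (f : ι → ℂ) (hf : ∀ i ∈ s, ‖f i‖ ≤ 1) :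
    ‖∏ i ∈ s, f i - 1‖ ≤ ∑ i ∈ s, ‖f i - 1‖ := by
  classical
  revert hf
  refine Finset.induction_on s (fun _ => by simp) ?_
  intro a s ha ih hf
  rw [Finset.prod_insert ha, Finset.sum_insert ha]
  have h1 : ‖f a‖ ≤ 1 := hf a (Finset.mem_insert_self a s)
  have h2 := ih fun i hi => hf i (Finset.mem_insert_of_mem hi)
  have h3 : ‖f a * (∏ i ∈ s, f i - 1)‖ ≤ ‖∏ i ∈ s, f i - 1‖ := by
    rw [norm_mul]
    exact mul_le_of_le_one_left (norm_nonneg _) h1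
  calc ‖f a * ∏ i ∈ s, f i - 1‖ = ‖f a * (∏ i ∈ s, f i - 1) + (f a - 1)‖ := by ring_nf
    _ ≤ ‖f a * (∏ i ∈ s, f i - 1)‖ + ‖f a - 1‖ := norm_add_le _ _
    _ ≤ ‖f a - 1‖ + ∑ i ∈ s, ‖f i - 1‖ := by linarith

/-- **`‖u_k(b) − 1‖ ≤ L^kε|e|·‖A‖_∞`** for `u = e^{ieεA}` and every bond `b` of `T^{(k)}`: the averaged field `u_k = lineIter u k` on a coarse bond
is the ordered product of the `L^k` fine bond variables along the straight run (r01's `toC_lineIter`), i.e. `exp(ieε Σ A)` with `|Σ A| ≤ L^k‖A‖_∞`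
(*«A is smooth and small»*, [I] p. 326; the [I] (4.5.4)-type bound on the averaged field). [cite: BalabanImbrieJaffe1985, (5.1.2)–(5.1.3) p.313] -/
theorem norm_toC_lineIter_expGauge_sub_one_le {k : ℕ} (hk : 0 + k ≤ P.m + P.K) (e : ℝ) {A : PBond P 0 → ℝ} {Asup : ℝ}
    (hsup : ∀ b, |A b| ≤ Asup) (b : PBond P (0 + k)) :
    ‖toC (lineIter (expGauge P e A) k b) - 1‖ ≤ P.spacing k * |e| * Asup := by
  obtain ⟨w, μ⟩ := b
  rw [toC_lineIter hk (expGauge P e A) w μ]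
  simp_rw [toC_expGauge]
  rw [← Complex.exp_sum]
  have e1 : ∑ s ∈ range (P.L ^ k), ((P.eps * e * A (runBond (cornerIter k w) μ s) : ℝ) : ℂ) * Complex.I =
      Complex.I * ((∑ s ∈ range (P.L ^ k), P.eps * e * A (runBond (cornerIter k w) μ s) : ℝ) : ℂ) := by
    rw [mul_comm, Complex.ofReal_sum, Finset.mul_sum]
    exact Finset.sum_congr rfl fun s _ => mul_comm _ _
  rw [e1]
  refine Real.norm_exp_I_mul_ofReal_sub_one_le.trans ?_
  rw [Real.norm_eq_abs]
  refine (Finset.abs_sum_le_sum_abs _ _).trans ?_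
  calc ∑ s ∈ range (P.L ^ k), |P.eps * e * A (runBond (cornerIter k w) μ s)|
      ≤ ∑ s ∈ range (P.L ^ k), P.eps * |e| * Asup := Finset.sum_le_sum fun s _ => by
        rw [abs_mul, abs_mul, abs_of_pos P.eps_pos]
        exact mul_le_mul_of_nonneg_left (hsup _) (mul_nonneg P.eps_pos.le (abs_nonneg e))
    _ = P.spacing k * |e| * Asup := by
        rw [sum_const, card_range, nsmul_eq_mul]
        unfold Params.spacing
        push_cast
        ring

/-- **`‖u_k(Γ_{yx}) − 1‖ ≤ d′(L−1)·T₁`** for a bond field `v` on `T^{(j)}` with `‖v(b) − 1‖ ≤ T₁` on every bond: the one-level transport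
`holCK v 1 y = v(Γ_{yx})` along the standard contour (at most `L − 1` bonds per direction) deviates from `1` by at most the sum of the bond deviations.
[cite: BalabanImbrieJaffe1985, (2.5) p.302] -/
theorem norm_holCK_one_sub_one_le {j : ℕ} (v : GaugeField P j U1) {T₁ : ℝ} (hv : ∀ b : PBond P j, ‖toC (v b) - 1‖ ≤ T₁)
    (y : Balaban1983to89.Site P j) : ‖holCK v 1 y - 1‖ ≤ P.d * ((P.L : ℝ) - 1) * T₁ := by
  have hT₁ : 0 ≤ T₁ := (norm_nonneg _).trans (hv ⟨y, ⟨0, P.hd⟩⟩)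
  have hL1 : (1 : ℝ) ≤ P.L := by exact_mod_cast P.L_pos
  rw [holCK_one]
  unfold holC
  have hleg : ∀ μ : Fin P.d, ‖legProd v y μ‖ ≤ 1 := fun μ => by
    unfold legProd
    rw [norm_prod]
    exact Finset.prod_le_one (fun _ _ => norm_nonneg _) fun _ _ => (norm_toC _).le
  refine (norm_prod_sub_one_le _ _ fun μ _ => hleg μ).trans ?_
  have hμ : ∀ μ : Fin P.d, ‖legProd v y μ - 1‖ ≤ ((P.L : ℝ) - 1) * T₁ := by
    intro μ
    unfold legProd
    refine (norm_prod_sub_one_le _ _ fun _ _ => (norm_toC _).le).trans ?_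
    calc ∑ t ∈ range (inBlock y μ), ‖toC (v (legBond y μ t)) - 1‖ ≤ ∑ t ∈ range (inBlock y μ), T₁ :=
          Finset.sum_le_sum fun t _ => hv _
      _ = (inBlock y μ : ℝ) * T₁ := by rw [sum_const, card_range, nsmul_eq_mul]
      _ ≤ ((P.L : ℝ) - 1) * T₁ := by
          refine mul_le_mul_of_nonneg_right ?_ hT₁
          have h : inBlock y μ + 1 ≤ P.L := Nat.mod_lt _ P.L_pos
          have : ((inBlock y μ : ℕ) : ℝ) + 1 ≤ P.L := by exact_mod_cast h
          linarith
  calc ∑ μ : Fin P.d, ‖legProd v y μ - 1‖ ≤ ∑ μ : Fin P.d, ((P.L : ℝ) - 1) * T₁ := Finset.sum_le_sum fun μ _ => hμ μ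
    _ = P.d * ((P.L : ℝ) - 1) * T₁ := by rw [sum_const, card_univ, Fintype.card_fin, nsmul_eq_mul]; ring

/-- **(2.40) AND (4.9)_{j≥1} AT A (2.23)-REGULAR AND BOUNDED `A`** (*«exp[ie_kηA], where A is smooth and small»*, [I] p. 326): as
`Z49_regular_torus_cwt`, the averaged-field smallness supplied by a sup bound `‖A‖_∞ ≤ A_∞` through §7's two lemmas — `T₁ = L^kε|e|A_∞`,
`δ′ = d′(L−1)T₁`, so the only condition on the field left is `2(L−1)L·d′·T₁² + 2δ′² ≤ σ` with these values. [cite: BalabanImbrieJaffe1988, (2.40) p.264]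
[cite: BalabanImbrieJaffe1988, (4.9) p.275] -/
theorem Z49_regular_torus_cwt_of_sup (d L : ℕ) (hL : 2 ≤ L) {a : ℝ} (ha : 0 < a) (e creg β : ℝ) (hcreg : 0 ≤ creg) (hβ : 0 < β) :
    ∃ s₀ : ℕ, ∀ s : ℕ, s₀ ≤ s → ∃ c₀ e₁ : ℝ, 0 < c₀ ∧ 0 < e₁ ∧
      ∀ (P : Params) (hPd : P.d = d + 1), P.L = L → ∀ (k : ℕ), 1 ≤ k → k ≤ P.K → k + s ≤ P.m + P.K → k + 1 ≤ P.m + P.K →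
      3 * (L ^ k * L ^ s) ≤ P.sitesPerDir 0 →
      ∀ (A : PBond P 0 → ℝ) (ec : ℝ), 0 < ec → ec ≤ e₁ →
      (∀ (z : Balaban1983to89.Site P 0) (μ ν : Fin P.d),
          P.spacing k * |e| / ec * |A ⟨z.shift μ, ν⟩ - A ⟨z, ν⟩| ≤ creg * ec ^ (β - 1) / (L : ℝ) ^ k) →
      ∀ (Asup : ℝ), (∀ b, |A b| ≤ Asup) →
      ∀ (c M0 : Fin (d + 1) → ℕ), (∀ i, c i * P.L ^ k + P.L ^ k * M0 i ≤ P.sitesPerDir 0) →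
      ∀ (sg W : ℕ), 1 ≤ sg → ∀ (R R₀ R₁ : ℝ), ((rowMargin L (d + 1) k s : ℕ) : ℝ) < R → 0 ≤ R₁ → R₁ < R₀ →
        2 * (sg : ℝ) / 3 + R₀ / 2 + R ≤ W → (∀ i, ((P.L ^ k * M0 i : ℕ) : ℝ) + R ≤ P.sitesPerDir 0) →
      ∀ (Λ : Finset (Balaban1983to89.Site P (0 + k))),
        (∀ y₁ ∈ Λ, ∀ μ, (c (Fin.cast hPd μ) : ℝ) * P.L ^ k + (R₀ + R) ≤ (P.L : ℝ) ^ k * (y₁ μ).val ∧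
          (P.L : ℝ) ^ k * (y₁ μ).val + P.L ^ k + (R₀ + R) ≤ (c (Fin.cast hPd μ) : ℝ) * P.L ^ k + (P.L : ℝ) ^ k * M0 (Fin.cast hPd μ)) →
      ∀ (σ : ℝ), 2 * (((P.L : ℝ) - 1) * P.L) * P.d * (P.spacing k * |e| * Asup) ^ 2 +
          2 * (P.d * ((P.L : ℝ) - 1) * (P.spacing k * |e| * Asup)) ^ 2 ≤ σ →
      ∀ (κ' : ℝ), 0 ≤ κ' →
        4 / 3 * (P.d : ℝ) ^ 4 * (2 * creg * ec ^ β) ^ 2 +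
            B1.aSeq a P.L k ^ 2 * (c₀ * Real.exp (1 / (8 * (L : ℝ) ^ s) / 2) * latticeConst P.d (1 / (8 * (L : ℝ) ^ s) / 2)) *
              ((((⌊(((P.L : ℝ) ^ k) - 1 + R₀) / sg⌋₊ : ℝ) + 3) ^ (d + 1)) *
                  Real.exp (-(1 / (8 * (L : ℝ) ^ s) * (((P.L : ℝ) ^ k)⁻¹ * (2 * R)))) +
                Real.exp (-(1 / (8 * (L : ℝ) ^ s) / 2 * (((P.L : ℝ) ^ k)⁻¹ * R₁)))) <
          c240 P (min (a / (9 * (P.d + 1))) (1 / 12)) κ' * (1 - σ) →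
      ∀ (Es N : ℝ),
        (realify (compress Λ (op240 (deltaLocT (B1RG242Torus.α P a k * (P.L : ℝ) ^ (k * P.d)) P.eps⁻¹ (expGauge P e A) k
            (cubeFamB hPd (P.L ^ k) c M0 sg W (L ^ k * L ^ s)) (lamFam hPd (P.L ^ k) c M0 sg) (cutoff R₁ R₀ (B5Ineq137Torus.T P 0)))
            ((B1RG242Torus.α P a k * (P.L : ℝ) ^ (k * P.d)) / B1.aSeq a P.L k * κ') (lineIter (expGauge P e A) k)))).PosDef ∧
        Z49 (realify (compress Λ (op240 (deltaLocT (B1RG242Torus.α P a k * (P.L : ℝ) ^ (k * P.d)) P.eps⁻¹ (expGauge P e A) k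
            (cubeFamB hPd (P.L ^ k) c M0 sg W (L ^ k * L ^ s)) (lamFam hPd (P.L ^ k) c M0 sg) (cutoff R₁ R₀ (B5Ineq137Torus.T P 0)))
            ((B1RG242Torus.α P a k * (P.L : ℝ) ^ (k * P.d)) / B1.aSeq a P.L k * κ') (lineIter (expGauge P e A) k)))) Es N =
          Real.exp (-(Es * N)) * (Real.sqrt (2 * Real.pi) ^ Fintype.card (↥Λ × Fin 2) /
            Real.sqrt (realify (compress Λ (op240 (deltaLocT (B1RG242Torus.α P a k * (P.L : ℝ) ^ (k * P.d)) P.eps⁻¹ (expGauge P e A) k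
              (cubeFamB hPd (P.L ^ k) c M0 sg W (L ^ k * L ^ s)) (lamFam hPd (P.L ^ k) c M0 sg) (cutoff R₁ R₀ (B5Ineq137Torus.T P 0)))
              ((B1RG242Torus.α P a k * (P.L : ℝ) ^ (k * P.d)) / B1.aSeq a P.L k * κ') (lineIter (expGauge P e A) k)))).det) ∧
        0 < Z49 (realify (compress Λ (op240 (deltaLocT (B1RG242Torus.α P a k * (P.L : ℝ) ^ (k * P.d)) P.eps⁻¹ (expGauge P e A) k
            (cubeFamB hPd (P.L ^ k) c M0 sg W (L ^ k * L ^ s)) (lamFam hPd (P.L ^ k) c M0 sg) (cutoff R₁ R₀ (B5Ineq137Torus.T P 0)))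
            ((B1RG242Torus.α P a k * (P.L : ℝ) ^ (k * P.d)) / B1.aSeq a P.L k * κ') (lineIter (expGauge P e A) k)))) Es N := by
  obtain ⟨s₀, H⟩ := Z49_regular_torus_cwt d L hL ha e creg β hcreg hβ
  refine ⟨s₀, fun s hs => ?_⟩
  obtain ⟨c₀, e₁, hc₀, he₁, M⟩ := H s hs
  refine ⟨c₀, e₁, hc₀, he₁, ?_⟩
  intro P hPd hPL k hk1 hkK hks hk' hsize A ec hec hece hreg Asup hsup c M0 hfit0 sg W hsg R R₀ R₁ hRm hR₁ hR10 hW hgap Λ hΛ σ hσ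
    κ' hκ' hE Es N
  have hk : 0 + k ≤ P.m + P.K := by omega
  have hInt := fun (b : PBond P (0 + k)) (_ : blkIter 1 b.src = blkIter 1 b.tgt) => norm_toC_lineIter_expGauge_sub_one_le hk e hsup b
  have hTree := norm_holCK_one_sub_one_le (lineIter (expGauge P e A) k) (fun b => norm_toC_lineIter_expGauge_sub_one_le hk e hsup b)
  exact M P hPd hPL k hk1 hkK hks hk' hsize A ec hec hece hreg c M0 hfit0 sg W hsg R R₀ R₁ hRm hR₁ hR10 hW hgap Λ hΛ _ _ σ hInt hTree hσ
    κ' hκ' hE Es N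

/-- **(2.41) AT A (2.23)-REGULAR AND BOUNDED `A`** (*«exp[ie_kηA], where A is smooth and small»*, [I] p. 326): as `decay241_regular_torus_cwt`,
the averaged-field smallness supplied by a sup bound `‖A‖_∞ ≤ A_∞` through §7's two lemmas (`T₁ = L^kε|e|A_∞`, `δ′ = d′(L−1)T₁`).
[cite: BalabanImbrieJaffe1988, (2.41) p.264] -/
theorem decay241_regular_torus_cwt_of_sup (d L : ℕ) (hL : 2 ≤ L) {a : ℝ} (ha : 0 < a) (e creg β : ℝ) (hcreg : 0 ≤ creg) (hβ : 0 < β) :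
    ∃ s₀ : ℕ, ∀ s : ℕ, s₀ ≤ s → ∃ c₀ e₁ : ℝ, 0 < c₀ ∧ 0 < e₁ ∧
      ∀ (P : Params) (hPd : P.d = d + 1), P.L = L → ∀ (k : ℕ), 1 ≤ k → k ≤ P.K → k + s ≤ P.m + P.K → k + 1 ≤ P.m + P.K →
      3 * (L ^ k * L ^ s) ≤ P.sitesPerDir 0 →
      ∀ (A : PBond P 0 → ℝ) (ec : ℝ), 0 < ec → ec ≤ e₁ →
      (∀ (z : Balaban1983to89.Site P 0) (μ ν : Fin P.d),
          P.spacing k * |e| / ec * |A ⟨z.shift μ, ν⟩ - A ⟨z, ν⟩| ≤ creg * ec ^ (β - 1) / (L : ℝ) ^ k) →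
      ∀ (Asup : ℝ), (∀ b, |A b| ≤ Asup) →
      ∀ (c M0 : Fin (d + 1) → ℕ), (∀ i, c i * P.L ^ k + P.L ^ k * M0 i ≤ P.sitesPerDir 0) →
      ∀ (sg W : ℕ), 1 ≤ sg → ∀ (R R₀ R₁ : ℝ), ((rowMargin L (d + 1) k s : ℕ) : ℝ) < R → 0 ≤ R₁ → R₁ < R₀ →
        2 * (sg : ℝ) / 3 + R₀ / 2 + R ≤ W → (∀ i, ((P.L ^ k * M0 i : ℕ) : ℝ) + R ≤ P.sitesPerDir 0) →
      ∀ (Λ : Finset (Balaban1983to89.Site P (0 + k))),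
        (∀ y₁ ∈ Λ, ∀ μ, (c (Fin.cast hPd μ) : ℝ) * P.L ^ k + (R₀ + R) ≤ (P.L : ℝ) ^ k * (y₁ μ).val ∧
          (P.L : ℝ) ^ k * (y₁ μ).val + P.L ^ k + (R₀ + R) ≤ (c (Fin.cast hPd μ) : ℝ) * P.L ^ k + (P.L : ℝ) ^ k * M0 (Fin.cast hPd μ)) →
      ∀ (σ : ℝ), 2 * (((P.L : ℝ) - 1) * P.L) * P.d * (P.spacing k * |e| * Asup) ^ 2 +
          2 * (P.d * ((P.L : ℝ) - 1) * (P.spacing k * |e| * Asup)) ^ 2 ≤ σ →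
      ∀ (κ' : ℝ), 0 ≤ κ' →
        4 / 3 * (P.d : ℝ) ^ 4 * (2 * creg * ec ^ β) ^ 2 +
            B1.aSeq a P.L k ^ 2 * (c₀ * Real.exp (1 / (8 * (L : ℝ) ^ s) / 2) * latticeConst P.d (1 / (8 * (L : ℝ) ^ s) / 2)) *
              ((((⌊(((P.L : ℝ) ^ k) - 1 + R₀) / sg⌋₊ : ℝ) + 3) ^ (d + 1)) *
                  Real.exp (-(1 / (8 * (L : ℝ) ^ s) * (((P.L : ℝ) ^ k)⁻¹ * (2 * R)))) +
                Real.exp (-(1 / (8 * (L : ℝ) ^ s) / 2 * (((P.L : ℝ) ^ k)⁻¹ * R₁)))) <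
          c240 P (min (a / (9 * (P.d + 1))) (1 / 12)) κ' * (1 - σ) →
      ∀ (ϑ : ℝ), 0 ≤ ϑ → ϑ ≤ 1 / (8 * (L : ℝ) ^ s) / 4 →
        ϑ * ((4 / (1 / (8 * (L : ℝ) ^ s))) * (2 * latticeConst P.d (1 / (8 * (L : ℝ) ^ s) / 2)) *
            (B1.aSeq a P.L k * (1 + (((⌊(((P.L : ℝ) ^ k) - 1 + R₀) / sg⌋₊ : ℝ) + 3) ^ (d + 1)) * B1.aSeq a P.L k *
                (c₀ * Real.exp (1 / (8 * (L : ℝ) ^ s)))) +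
              κ' * (((P.L : ℝ) ^ P.d)⁻¹) ^ 2 * Real.exp (1 / (8 * (L : ℝ) ^ s) * ((P.L : ℝ) - 1)))) ≤
          (c240 P (min (a / (9 * (P.d + 1))) (1 / 12)) κ' * (1 - σ) -
            (4 / 3 * (P.d : ℝ) ^ 4 * (2 * creg * ec ^ β) ^ 2 +
              B1.aSeq a P.L k ^ 2 * (c₀ * Real.exp (1 / (8 * (L : ℝ) ^ s) / 2) * latticeConst P.d (1 / (8 * (L : ℝ) ^ s) / 2)) *
                ((((⌊(((P.L : ℝ) ^ k) - 1 + R₀) / sg⌋₊ : ℝ) + 3) ^ (d + 1)) *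
                    Real.exp (-(1 / (8 * (L : ℝ) ^ s) * (((P.L : ℝ) ^ k)⁻¹ * (2 * R)))) +
                  Real.exp (-(1 / (8 * (L : ℝ) ^ s) / 2 * (((P.L : ℝ) ^ k)⁻¹ * R₁)))))) / 2 →
      ∀ (x₁ x₂ : ↥Λ),
        ‖(compress Λ (op240 (deltaLocT (B1RG242Torus.α P a k * (P.L : ℝ) ^ (k * P.d)) P.eps⁻¹ (expGauge P e A) k
            (cubeFamB hPd (P.L ^ k) c M0 sg W (L ^ k * L ^ s)) (lamFam hPd (P.L ^ k) c M0 sg) (cutoff R₁ R₀ (B5Ineq137Torus.T P 0)))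
            ((B1RG242Torus.α P a k * (P.L : ℝ) ^ (k * P.d)) / B1.aSeq a P.L k * κ') (lineIter (expGauge P e A) k)))⁻¹ x₁ x₂‖ ≤
          ((B1RG242Torus.α P a k * (P.L : ℝ) ^ (k * P.d)) / B1.aSeq a P.L k)⁻¹ *
            (4 / (c240 P (min (a / (9 * (P.d + 1))) (1 / 12)) κ' * (1 - σ) -
              (4 / 3 * (P.d : ℝ) ^ 4 * (2 * creg * ec ^ β) ^ 2 +
                B1.aSeq a P.L k ^ 2 * (c₀ * Real.exp (1 / (8 * (L : ℝ) ^ s) / 2) * latticeConst P.d (1 / (8 * (L : ℝ) ^ s) / 2)) *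
                  ((((⌊(((P.L : ℝ) ^ k) - 1 + R₀) / sg⌋₊ : ℝ) + 3) ^ (d + 1)) *
                      Real.exp (-(1 / (8 * (L : ℝ) ^ s) * (((P.L : ℝ) ^ k)⁻¹ * (2 * R)))) +
                    Real.exp (-(1 / (8 * (L : ℝ) ^ s) / 2 * (((P.L : ℝ) ^ k)⁻¹ * R₁))))))) *
            Real.exp (-(ϑ * B5Ineq137Torus.T P (0 + k) x₁ x₂)) := by
  obtain ⟨s₀, H⟩ := decay241_regular_torus_cwt d L hL ha e creg β hcreg hβ
  refine ⟨s₀, fun s hs => ?_⟩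
  obtain ⟨c₀, e₁, hc₀, he₁, M⟩ := H s hs
  refine ⟨c₀, e₁, hc₀, he₁, ?_⟩
  intro P hPd hPL k hk1 hkK hks hk' hsize A ec hec hece hreg Asup hsup c M0 hfit0 sg W hsg R R₀ R₁ hRm hR₁ hR10 hW hgap Λ hΛ σ hσ
    κ' hκ' hE ϑ hϑ0 hϑ hsmall x₁ x₂
  have hk : 0 + k ≤ P.m + P.K := by omega
  have hInt := fun (b : PBond P (0 + k)) (_ : blkIter 1 b.src = blkIter 1 b.tgt) => norm_toC_lineIter_expGauge_sub_one_le hk e hsup b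
  have hTree := norm_holCK_one_sub_one_le (lineIter (expGauge P e A) k) (fun b => norm_toC_lineIter_expGauge_sub_one_le hk e hsup b)
  exact M P hPd hPL k hk1 hkK hks hk' hsize A ec hec hece hreg c M0 hfit0 sg W hsg R R₀ R₁ hRm hR₁ hR10 hW hgap Λ hΛ _ _ σ hInt hTree hσ
    κ' hκ' hE ϑ hϑ0 hϑ hsmall x₁ x₂

end SupBound

end

end Literature.MathematicalPhysics.QuantumFieldTheory.BalabanImbrieJaffe1984to88.BIJ88Decay241RegularTorusCwt
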